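import Literature.RingTheory.Flat.IsomorphismModuloNilpotent
import Mathlib.Algebra.Category.Ring.Constructions
import Mathlib.RingTheory.Ideal.Maps
import Mathlib.RingTheory.Ideal.Quotient.Operations
import HarnessLib

/-!
# A ring map over a nilpotent thickening of the base is an isomorphism if it is one modulo the ideal

Topic `Literature/RingTheory/Flat`; theorems only (no definition, no named fact, no instance).
Schlessinger's Lemma 3.3 ([Schlessinger1968] p. 216; tree form
`Literature.RingTheory.Flat.bijective_of_bijective_mapQ_of_isNilpotent`: «`u : M → N` a map of
`A`-modules, `N` flat over `A`, `J` nilpotent; if `ū : M/JM → N/JN` is an isomorphism then `u` is an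
isomorphism») in the PUSHOUT currency read off affine charts of schemes over an infinitesimal
thickening of the base (`Literature/AlgebraicGeometry/Morphisms/`):

* `surjective_and_ker_eq_of_isPushout_of_surjective` — if `ρ : R ⟶ R₀` is surjective and `A₀` is a
  pushout of `A ← R → R₀`, then `A → A₀` is surjective with kernel `JA`, `J = ker ρ`
  (`A₀ = A ⊗_R R/J = A/JA`, [AtiyahMacdonald1969] Ch. 2 Exercise 2).
* `bijective_of_isPushout_of_isNilpotent_ker` — `ρ : R ⟶ R₀` surjective with NILPOTENT kernel,
  `A₀` a pushout of `A ← R → R₀`, `B₀` a pushout of `B ← A → A₀`; if `R → B` is flat and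
  `A₀ → B₀` is bijective then `A → B` is bijective (no finiteness hypothesis).

## References
* [Schlessinger1968] M. Schlessinger, *Functors of Artin rings*, Trans. AMS 130 (1968), Lemma 3.3,
  p. 216.
* [AtiyahMacdonald1969] M. Atiyah, I. Macdonald, *Introduction to Commutative Algebra*, Ch. 2,
  Exercise 2 (p. 31): `(A/𝔞) ⊗_A M ≅ M/𝔞M`.
-/

universe u

open CategoryTheory CategoryTheory.Limits

namespace Literature.RingTheory.Flat

open Literature.RingTheory.AdicTopology (smul_top_le_comap_smul_top)

variable {R R₀ A A₀ B B₀ : CommRingCat.{u}}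

/-- **The pushout of a surjection is the quotient by the extended kernel.** Let `ρ : R ⟶ R₀` be a
surjective ring map with kernel `J` and let
```
R --a--> A
|ρ       |i
v        v
R₀ -a₀-> A₀
```
be a pushout square in `CommRingCat`. Then `i` is surjective and `ker i = JA` (`A₀ ≅ A ⊗_R R/J ≅
A/JA`). [cite: AtiyahMacdonald1969, Ch. 2 Exercise 2 (p. 31)] -/
theorem surjective_and_ker_eq_of_isPushout_of_surjective {ρ : R ⟶ R₀}
    (hρ : Function.Surjective ρ.hom) {a : R ⟶ A} {i : A ⟶ A₀} {a₀ : R₀ ⟶ A₀}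
    (hA : IsPushout a ρ i a₀) :
    Function.Surjective i.hom ∧ RingHom.ker i.hom = (RingHom.ker ρ.hom).map a.hom := by
  classical
  set I : Ideal A := (RingHom.ker ρ.hom).map a.hom with hIdef
  let Q : CommRingCat.{u} := CommRingCat.of (A ⧸ I)
  let mk : A ⟶ Q := CommRingCat.ofHom (Ideal.Quotient.mk I)
  -- `R → A → A/I` kills `ker ρ`, hence factors through `ρ`
  have hker : RingHom.ker ρ.hom ≤ RingHom.ker ((Ideal.Quotient.mk I).comp a.hom) := by
    intro r hr
    rw [RingHom.mem_ker, RingHom.comp_apply, Ideal.Quotient.eq_zero_iff_mem]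
    exact Ideal.mem_map_of_mem _ hr
  let ρbar : R₀ ⟶ Q := CommRingCat.ofHom (ρ.hom.liftOfSurjective hρ ⟨_, hker⟩)
  have hρbar : a ≫ mk = ρ ≫ ρbar := by
    ext r
    change Ideal.Quotient.mk I (a.hom r) = (ρ.hom.liftOfSurjective hρ ⟨_, hker⟩) (ρ.hom r)
    rw [RingHom.liftOfSurjective_comp_apply]
    rfl
  -- `u : A₀ → A/I` from the pushout, `v : A/I → A₀` from the quotient
  let u : A₀ ⟶ Q := hA.desc mk ρbar hρbar
  have hu : i ≫ u = mk := hA.inl_desc mk ρbar hρbar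
  have hIi : ∀ x ∈ I, i.hom x = 0 := by
    have hle : I ≤ RingHom.ker i.hom := by
      rw [hIdef, Ideal.map_le_iff_le_comap]
      intro r hr
      have h := congrArg (fun ψ : R ⟶ A₀ => ψ.hom r) hA.w
      change i.hom (a.hom r) = a₀.hom (ρ.hom r) at h
      rw [Ideal.mem_comap, RingHom.mem_ker, h, RingHom.mem_ker.mp hr, map_zero]
    exact fun x hx => hle hx
  let v : Q ⟶ A₀ := CommRingCat.ofHom (Ideal.Quotient.lift I i.hom hIi)
  have hv : mk ≫ v = i := by
    ext x
    rfl
  -- `u ≫ v = 𝟙` (pushout uniqueness) and `v ≫ u = 𝟙` (quotient uniqueness)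
  have huv : u ≫ v = 𝟙 A₀ := by
    apply hA.hom_ext
    · rw [← Category.assoc, hu, hv, Category.comp_id]
    · rw [Category.comp_id]
      ext y
      obtain ⟨r, rfl⟩ := hρ y
      have h1 := congrArg (fun ψ : R ⟶ A₀ => ψ.hom r) hA.w
      change i.hom (a.hom r) = a₀.hom (ρ.hom r) at h1
      change v.hom (u.hom (a₀.hom (ρ.hom r))) = a₀.hom (ρ.hom r)
      rw [← h1]
      change (i ≫ u ≫ v).hom (a.hom r) = i.hom (a.hom r)
      rw [← Category.assoc, hu, hv]
  have hvu : v ≫ u = 𝟙 Q := by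
    apply CommRingCat.hom_ext
    apply Ideal.Quotient.ringHom_ext
    ext x
    change u.hom (v.hom (Ideal.Quotient.mk I x)) = Ideal.Quotient.mk I x
    exact congrArg (fun ψ : A ⟶ Q => ψ.hom x) hu
  have hv_inj : Function.Injective v.hom := by
    intro x y hxy
    have h := congrArg u.hom hxy
    have hx := congrArg (fun ψ : Q ⟶ Q => ψ.hom x) hvu
    have hy := congrArg (fun ψ : Q ⟶ Q => ψ.hom y) hvu
    change u.hom (v.hom x) = x at hx
    change u.hom (v.hom y) = y at hy
    rw [← hx, ← hy, h]
  have hv_surj : Function.Surjective v.hom := by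
    intro z
    refine ⟨u.hom z, ?_⟩
    have h := congrArg (fun ψ : A₀ ⟶ A₀ => ψ.hom z) huv
    exact h
  refine ⟨?_, ?_⟩
  · -- `i = v ∘ mk`
    rw [← hv]
    exact hv_surj.comp Ideal.Quotient.mk_surjective
  · ext x
    rw [RingHom.mem_ker, ← hv]
    change v.hom (Ideal.Quotient.mk I x) = 0 ↔ x ∈ I
    rw [map_eq_zero_iff _ hv_inj, Ideal.Quotient.eq_zero_iff_mem]

/-- **Schlessinger's Lemma 3.3 in pushout form.** Let `ρ : R ⟶ R₀` be a surjective ring map with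
NILPOTENT kernel, `a : R ⟶ A`, and let
```
R  --a--> A --φ--> B
|ρ        |i       |j
v         v        v
R₀ -a₀--> A₀ -φ₀-> B₀
```
be two pushout squares (`A₀ = A/JA`, `B₀ = B/JB`, `J = ker ρ`). If `R → B` is flat and `φ₀` is
bijective, then `φ` is bijective. («Let `u : M → N` be a morphism of `A`-modules with `N` flat
over `A`; if `ū : M/JM → N/JN` is an isomorphism then `u` is an isomorphism» — with `A := R`,
`M := A`, `N := B`, `u := φ`; the identifications `A/JA = A₀`, `B/JB = B₀` are
`surjective_and_ker_eq_of_isPushout_of_surjective`.) [cite: Schlessinger1968, Lemma 3.3, p. 216] -/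
theorem bijective_of_isPushout_of_isNilpotent_ker {ρ : R ⟶ R₀} (hρ : Function.Surjective ρ.hom)
    (hnil : IsNilpotent (RingHom.ker ρ.hom)) {a : R ⟶ A} {i : A ⟶ A₀} {a₀ : R₀ ⟶ A₀}
    (hA : IsPushout a ρ i a₀) {φ : A ⟶ B} {j : B ⟶ B₀} {φ₀ : A₀ ⟶ B₀}
    (hB : IsPushout φ i j φ₀) (hRB : (a ≫ φ).hom.Flat) (hφ₀ : Function.Bijective φ₀.hom) :
    Function.Bijective φ.hom := by
  classical
  -- `R`-module structures along `R → A → B`, `R → A₀ → B₀`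
  letI : Algebra R A := a.hom.toAlgebra
  letI : Algebra R B := (a ≫ φ).hom.toAlgebra
  haveI : Module.Flat R B := hRB
  set J : Ideal R := RingHom.ker ρ.hom with hJdef
  -- the outer square `R → B` is a pushout too
  have hAB : IsPushout (a ≫ φ) ρ j (a₀ ≫ φ₀) := hA.paste_horiz hB
  obtain ⟨hi, hkeri⟩ := surjective_and_ker_eq_of_isPushout_of_surjective hρ hA
  obtain ⟨hj, hkerj⟩ := surjective_and_ker_eq_of_isPushout_of_surjective hρ hAB
  -- the maps as `R`-linear maps
  let φR : A →ₗ[R] B :=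
    { toFun := φ.hom
      map_add' := fun x y => map_add _ x y
      map_smul' := fun r x => by
        change φ.hom (a.hom r * x) = (a ≫ φ).hom r * φ.hom x
        rw [map_mul]
        rfl }
  letI : Algebra R A₀ := (a ≫ i).hom.toAlgebra
  letI : Algebra R B₀ := (a ≫ φ ≫ j).hom.toAlgebra
  let iR : A →ₗ[R] A₀ :=
    { toFun := i.hom
      map_add' := fun x y => map_add _ x y
      map_smul' := fun r x => by
        change i.hom (a.hom r * x) = (a ≫ i).hom r * i.hom x
        rw [map_mul]
        rfl }
  let jR : B →ₗ[R] B₀ :=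
    { toFun := j.hom
      map_add' := fun x y => map_add _ x y
      map_smul' := fun r x => by
        change j.hom ((a ≫ φ).hom r * x) = (a ≫ φ ≫ j).hom r * j.hom x
        rw [map_mul]
        rfl }
  -- `φ ≫ j = i ≫ φ₀` pointwise
  have hsq : ∀ x, j.hom (φ.hom x) = φ₀.hom (i.hom x) := fun x =>
    congrArg (fun ψ : A ⟶ B₀ => ψ.hom x) hB.w
  -- kernels as `R`-submodules: `ker i = J • ⊤`, `ker j = J • ⊤`
  have hkeriR : LinearMap.ker iR = J • (⊤ : Submodule R A) := by
    rw [Ideal.smul_top_eq_map]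
    ext x
    change i.hom x = 0 ↔ x ∈ (J.map (algebraMap R A))
    rw [← RingHom.mem_ker, hkeri]
    rfl
  have hkerjR : LinearMap.ker jR = J • (⊤ : Submodule R B) := by
    rw [Ideal.smul_top_eq_map]
    ext x
    change j.hom x = 0 ↔ x ∈ (J.map (algebraMap R B))
    rw [← RingHom.mem_ker, hkerj]
    rfl
  -- the induced bijections `A/JA → A₀`, `B/JB → B₀`
  let ī : (A ⧸ (J • (⊤ : Submodule R A))) →ₗ[R] A₀ :=
    (J • (⊤ : Submodule R A)).liftQ iR hkeriR.ge
  let jbar : (B ⧸ (J • (⊤ : Submodule R B))) →ₗ[R] B₀ :=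
    (J • (⊤ : Submodule R B)).liftQ jR hkerjR.ge
  have hī : Function.Bijective ī := by
    refine ⟨LinearMap.ker_eq_bot.mp (Submodule.ker_liftQ_eq_bot _ _ _ hkeriR.le), fun z => ?_⟩
    obtain ⟨x, rfl⟩ := hi z
    exact ⟨Submodule.Quotient.mk x, by rw [Submodule.liftQ_apply]; rfl⟩
  have hjbar : Function.Bijective jbar := by
    refine ⟨LinearMap.ker_eq_bot.mp (Submodule.ker_liftQ_eq_bot _ _ _ hkerjR.le), fun z => ?_⟩
    obtain ⟨x, rfl⟩ := hj z
    exact ⟨Submodule.Quotient.mk x, by rw [Submodule.liftQ_apply]; rfl⟩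
  -- Schlessinger's lemma
  refine bijective_of_bijective_mapQ_of_isNilpotent hnil φR ?_
  -- `jbar ∘ φ̄ = φ₀ ∘ ī`
  have key : ∀ q, jbar (Submodule.mapQ _ _ φR (smul_top_le_comap_smul_top J φR) q) =
      φ₀.hom (ī q) := by
    intro q
    induction q using Submodule.Quotient.induction_on with
    | H x =>
      rw [Submodule.mapQ_apply, Submodule.liftQ_apply, Submodule.liftQ_apply]
      exact hsq x
  have hcomp : (fun q => Submodule.mapQ _ _ φR (smul_top_le_comap_smul_top J φR) q) =
      fun q => (Equiv.ofBijective jbar hjbar).symm (φ₀.hom (ī q)) := by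
    funext q
    apply hjbar.1
    rw [key q]
    exact ((Equiv.ofBijective jbar hjbar).apply_symm_apply _).symm
  change Function.Bijective (fun q => Submodule.mapQ _ _ φR (smul_top_le_comap_smul_top J φR) q)
  rw [hcomp]
  exact (Equiv.ofBijective jbar hjbar).symm.bijective.comp (hφ₀.comp hī)

end Literature.RingTheory.Flat
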